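import Summits.Schanuel.Schanuel.Theorems.ZilberEacRealLineEdgeTools
import HarnessLib

/-!
# Non-split surfaces over a line of REAL IRRATIONAL slope, IV: tilted windows

HONEST FRAMING.  Cell `pub-schanuel` (Zilber's Exponential-Algebraic Closedness, case ladder;
host summit Schanuel), seat 2, gen 18 (HANDOFF O68 (a)).  Let `a ∈ ℝ ∖ ℚ`, `b ∈ ℂ`,
`P = Σ_d c_d x^{d₀} y₀^{d₁} y₁^{d₂} ∈ ℂ[x; y₀, y₁]`, and let `d₀ + μ(d₁ + a d₂) ≤ κ` be an upper
supporting line of the points `(d₁ + a d₂, d₀)` (REAL columns `w(d) = d₁ + a d₂`, pairwise distinct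
for distinct `(d₁, d₂)` since `a ∉ ℚ`), with edge `E = {d : d₀ + μ w(d) = κ}` and EDGE POLYNOMIAL
`R_E = Σ_{d ∈ E} c_d i^{d₀} y₀^{d₁} y₁^{d₂} ∈ ℂ[y₀, y₁]`.  In the TILTED window
`z = ζ + μ log(2πn) + 2πin` (`n ∈ ℕ` large):
`P(z; e^z, e^{az+b}) = (2πn)^κ · Ψ_v(ζ)`, `Ψ_v(ζ) = Σ_d c_d i^{d₀} s_d (1 + εζ + η)^{d₀} (e^ζ)^{d₁}(u e^{aζ+b})^{d₂}`
with `u = e^{2πina}`, `ε = 1/(2πin)`, `η = εμ log(2πn)`, `s_d = (2πn)^{-(κ - d₀ - μw(d))}` (`= 1` on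
`E`, `→ 0` off `E`), and `Ψ_{(u,0,0,0)}(ζ) = R_E(e^ζ, u e^{aζ+b})`.  Persistence of zeros (parameter in
the proper space `ℂ × ℂ × ℂ × ℂ^{supp P}`) and Kronecker with positive multipliers give
**`exists_zero_at_far_tilted_window`**: a unimodular zero `(u₀, x₀)` of the edge family produces
zeros `z = ζ + μ log(2πn) + 2πin` of `P(z; e^z, e^{az+b})` with `n ≥ N`, `e^{2πina} ≈ u₀`, `ζ ≈ x₀`.
Along such zeros `log|y₀| = μ log(2πn) + O(1)`, `log|y₁| = aμ log(2πn) + O(1)` — the input of the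
power-growth elimination (`ZilberEacRealLineSurfaceAll`).  NOT Schanuel's conjecture (neither used
nor implied; EAC ⇏ SC); `EC(3,2)` stays OPEN.
-/

noncomputable section

open Filter Topology Metric Set Complex MvPolynomial
open Literature.NumberTheory.Transcendental Literature.ModelTheory.Zilber
open Literature.ModelTheory.ExponentialFields

set_option linter.dupNamespace false

namespace Summit.Schanuel.Schanuel.Theorems

section Tilted

variable (a : ℝ) (b : ℂ) (P : MvPolynomial (Fin 3) ℂ)

/-- **Monomial expansion** of `P(z; y)` at the twisted fibre point: `Σ_d c_d z^{d₀} (Y^{tail d})`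
with `Y^{m} = (e^ζ)^{m₀}(u e^{aζ+b})^{m₁}`, written with `curveFn` of the monic monomial. [folklore] -/
theorem eval_fin3_eq_sum_monomials (u ζ x : ℂ) :
    MvPolynomial.eval (Fin.cons x (rfPt a b u ζ) : Fin 3 → ℂ) P =
      ∑ d ∈ P.support, P.coeff d * x ^ (d 0) *
        curveFn a b (monomial (Finsupp.tail d) (1 : ℂ)) u ζ := by
  have e : (Fin.cons x (rfPt a b u ζ) : Fin 3 → ℂ) = ![x, exp ζ, u * exp ((a : ℂ) * ζ + b)] := by
    funext i; refine Fin.cases ?_ (fun j => ?_) i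
    · rfl
    · fin_cases j <;> rfl
  rw [e, MvPolynomial.eval_eq']
  refine Finset.sum_congr rfl fun d _ => ?_
  rw [curveFn, MvPolynomial.eval_monomial, Finsupp.prod_pow, Fin.prod_univ_three, Fin.prod_univ_two,
    one_mul, Finsupp.tail_apply, Finsupp.tail_apply, rfPt_zero, rfPt_one]
  simp only [Matrix.cons_val_zero, Matrix.cons_val_one, Matrix.cons_val, Fin.succ_zero_eq_one,
    Fin.succ_one_eq_two]
  ring

/-- The window shift of the twisted fibre point by a REAL amount `μL`:
`Y(ζ + μL)^m = Y(ζ)^m · e^{μL(m₀ + a m₁)}` (coordinatewise `e^{ζ+μL} = e^ζe^{μL}`,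
`e^{a(ζ+μL)+b} = e^{aζ+b}e^{aμL}`). [folklore] -/
theorem curveFn_monomial_add_real (u ζ : ℂ) (t : ℝ) (m : Fin 2 →₀ ℕ) :
    curveFn a b (monomial m (1 : ℂ)) u (ζ + t) =
      curveFn a b (monomial m (1 : ℂ)) u ζ * (Real.exp (t * ((m 0 : ℝ) + a * (m 1 : ℝ))) : ℂ) := by
  set r : ℝ := t * ((m 0 : ℝ) + a * (m 1 : ℝ)) with hr
  rw [curveFn, curveFn, MvPolynomial.eval_monomial, MvPolynomial.eval_monomial, Finsupp.prod_pow,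
    Finsupp.prod_pow, Fin.prod_univ_two, Fin.prod_univ_two, rfPt_zero, rfPt_one, rfPt_zero, rfPt_one,
    one_mul, one_mul, Complex.ofReal_exp]
  have e1 : exp (ζ + t) = exp ζ * exp (t : ℂ) := by rw [Complex.exp_add]
  have e2 : u * exp ((a : ℂ) * (ζ + t) + b) = u * exp ((a : ℂ) * ζ + b) * exp ((a * t : ℝ) : ℂ) := by
    rw [show (a : ℂ) * (ζ + t) + b = ((a : ℂ) * ζ + b) + ((a * t : ℝ) : ℂ) by push_cast; ring,
      Complex.exp_add, mul_assoc]
  rw [e1, e2, mul_pow, mul_pow]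
  have e3 : exp (t : ℂ) ^ (m 0) * exp ((a * t : ℝ) : ℂ) ^ (m 1) = exp (r : ℂ) := by
    rw [← Complex.exp_nat_mul, ← Complex.exp_nat_mul, ← Complex.exp_add]
    congr 1; rw [hr]; push_cast; ring
  rw [← e3]; ring

/-- **Zeros in far TILTED windows.**  `a ∈ ℝ ∖ ℚ`; `d₀ + μ(d₁ + a d₂) ≤ κ` an upper supporting line
of `supp P`; `(u₀, x₀)` a zero of the edge family `Φ^E_u(ζ) = R_E(e^ζ, u e^{aζ+b})` with `|u₀| = 1`
and `Φ^E_{u₀} ≢ 0`.  Then for every `ε > 0` and `N` there are `n ∈ ℕ`, `n ≥ N`, `n ≥ 1`, with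
`|e^{2πina} - u₀| < ε` and a zero `z = ζ + μ log(2πn) + 2πin` of `P(z; e^z, e^{az+b})` with
`|ζ - x₀| < ε`. (new) -/
theorem exists_zero_at_far_tilted_window {a : ℝ} (ha : Irrational a) (b : ℂ)
    (P : MvPolynomial (Fin 3) ℂ) (μ κ : ℝ)
    (hκ : ∀ d ∈ P.support, ((d 0 : ℕ) : ℝ) + μ * ((d 1 : ℕ) + a * (d 2 : ℕ)) ≤ κ)
    {u₀ x₀ : ℂ} (hu₀ : ‖u₀‖ = 1)
    (hne : ∃ z, curveFn a b (∑ d ∈ P.support.filter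
        (fun d : Fin 3 →₀ ℕ => ((d 0 : ℕ) : ℝ) + μ * ((d 1 : ℕ) + a * (d 2 : ℕ)) = κ),
        monomial (Finsupp.tail d) (P.coeff d * I ^ (d 0))) u₀ z ≠ 0)
    (hx₀ : curveFn a b (∑ d ∈ P.support.filter
        (fun d : Fin 3 →₀ ℕ => ((d 0 : ℕ) : ℝ) + μ * ((d 1 : ℕ) + a * (d 2 : ℕ)) = κ),
        monomial (Finsupp.tail d) (P.coeff d * I ^ (d 0))) u₀ x₀ = 0)
    {ε : ℝ} (hε : 0 < ε) (N : ℕ) :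
    ∃ (n : ℕ) (ζ : ℂ), N ≤ n ∧ 1 ≤ n ∧ ‖urot (n * a) - u₀‖ < ε ∧ ‖ζ - x₀‖ < ε ∧
      MvPolynomial.eval (Fin.cons (ζ + μ * Real.log (2 * Real.pi * n) + n * (2 * Real.pi * I))
        (rfPt a b 1 (ζ + μ * Real.log (2 * Real.pi * n) + n * (2 * Real.pi * I))) : Fin 3 → ℂ) P = 0 := by
  classical
  -- notation: weights, edge, excess exponents
  set w : (Fin 3 →₀ ℕ) → ℝ := fun d => (d 1 : ℝ) + a * (d 2 : ℝ) with hw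
  set Edge := P.support.filter (fun d : Fin 3 →₀ ℕ => ((d 0 : ℕ) : ℝ) + μ * ((d 1 : ℕ) + a * (d 2 : ℕ)) = κ)
    with hEdge
  set ex : (Fin 3 →₀ ℕ) → ℝ := fun d => κ - ((d 0 : ℝ) + μ * w d) with hex
  have hex0 : ∀ d ∈ P.support, 0 ≤ ex d := fun d hd => by
    have := hκ d hd; simp only [hex, hw]; linarith
  have hexE : ∀ d ∈ P.support, d ∉ Edge → 0 < ex d := fun d hd hdE => by
    have h1 := hκ d hd
    have h2 : ((d 0 : ℕ) : ℝ) + μ * ((d 1 : ℕ) + a * (d 2 : ℕ)) ≠ κ := fun h =>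
      hdE (Finset.mem_filter.2 ⟨hd, h⟩)
    simp only [hex, hw]
    exact sub_pos.2 (lt_of_le_of_ne h1 h2)
  have hexEdge : ∀ d ∈ Edge, ex d = 0 := fun d hd => by
    obtain ⟨-, h⟩ := Finset.mem_filter.1 hd; simp only [hex, hw]; linarith
  -- opaque twisted monomials
  obtain ⟨cf, hcf, hcf_cont, hcf_diff⟩ : ∃ cf : MvPolynomial (Fin 2) ℂ → ℂ → ℂ → ℂ,
      cf = curveFn a b ∧ (∀ R, Continuous fun p : ℂ × ℂ => cf R p.1 p.2) ∧
      ∀ R u, Differentiable ℂ (cf R u) :=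
    ⟨_, rfl, continuous_curveFn a b, differentiable_curveFn a b⟩
  rw [← hcf] at hne hx₀
  -- the parameter space and the family
  let V := ℂ × ℂ × ℂ × (↥P.support → ℂ)
  obtain ⟨S, hS⟩ : ∃ S : V → (Fin 3 →₀ ℕ) → ℂ, ∀ v d, S v d =
      if d ∈ Edge then 1 else if hd : d ∈ P.support then v.2.2.2 ⟨d, hd⟩ else 0 :=
    ⟨_, fun _ _ => rfl⟩
  obtain ⟨Ψ, hΨ⟩ : ∃ Ψ : V → ℂ → ℂ, ∀ v ζ, Ψ v ζ = ∑ d ∈ P.support,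
      P.coeff d * I ^ (d 0) * S v d * (1 + v.2.1 * ζ + v.2.2.1) ^ (d 0) *
        cf (monomial (Finsupp.tail d) 1) v.1 ζ := ⟨_, fun _ _ => rfl⟩
  have hS_cont : ∀ d, Continuous fun v : V => S v d := by
    intro d
    by_cases hdE : d ∈ Edge
    · simp only [hS, hdE, if_true]; exact continuous_const
    · by_cases hd : d ∈ P.support
      · simp only [hS, hdE, if_false, hd, dif_pos]
        exact (continuous_apply _).comp (continuous_snd.comp (continuous_snd.comp continuous_snd))
      · simp only [hS, hdE, if_false, hd, dif_neg, not_false_eq_true, continuous_const]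
  have hcont : Continuous fun p : V × ℂ => Ψ p.1 p.2 := by
    simp only [hΨ]
    refine continuous_finsetSum _ fun d _ => ?_
    have h1 : Continuous fun p : V × ℂ => p.1.2.1 := continuous_fst.comp (continuous_snd.comp continuous_fst)
    have h2 : Continuous fun p : V × ℂ => p.1.2.2.1 :=
      continuous_fst.comp (continuous_snd.comp (continuous_snd.comp continuous_fst))
    have h3 : Continuous fun p : V × ℂ => cf (monomial (Finsupp.tail d) 1) p.1.1 p.2 :=
      (hcf_cont _).comp ((continuous_fst.comp continuous_fst).prodMk continuous_snd)
    have h4 : Continuous fun p : V × ℂ => S p.1 d := (hS_cont d).comp continuous_fst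
    exact (((continuous_const.mul h4).mul
      (((continuous_const.add (h1.mul continuous_snd)).add h2).pow _)).mul h3)
  have hdiff : ∀ v, Differentiable ℂ (Ψ v) := by
    intro v
    have e : Ψ v = fun ζ => ∑ d ∈ P.support,
        P.coeff d * I ^ (d 0) * S v d * (1 + v.2.1 * ζ + v.2.2.1) ^ (d 0) *
          cf (monomial (Finsupp.tail d) 1) v.1 ζ := funext (hΨ v)
    rw [e]
    refine Differentiable.fun_sum fun d _ => ?_
    exact ((differentiable_const _).mul ((((differentiable_const _).add
      ((differentiable_const _).mul differentiable_id)).add (differentiable_const _)).pow _)).mul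
      (hcf_diff _ v.1)
  -- the family at the base parameter is the edge family
  set v₀ : V := (u₀, 0, 0, fun _ => 0) with hv₀
  have hS0 : ∀ d ∈ P.support, S v₀ d = if d ∈ Edge then 1 else 0 := by
    intro d hd
    rw [hS]
    by_cases hdE : d ∈ Edge
    · simp [hdE]
    · simp [hdE, hd, hv₀]
  have hΨ0 : ∀ ζ, Ψ v₀ ζ = cf (∑ d ∈ Edge, monomial (Finsupp.tail d) (P.coeff d * I ^ (d 0))) u₀ ζ := by
    intro ζ
    rw [hΨ, hcf]
    simp only [curveFn, map_sum]
    rw [hEdge, Finset.sum_filter]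
    refine Finset.sum_congr rfl fun d hd => ?_
    rw [hS0 d hd]
    by_cases hdE : d ∈ Edge
    · rw [if_pos hdE, if_pos (Finset.mem_filter.1 hdE).2]
      simp only [hv₀, zero_mul, add_zero, one_pow, mul_one]
      rw [MvPolynomial.eval_monomial, MvPolynomial.eval_monomial, one_mul]
    · have hne' : ¬ (((d 0 : ℕ) : ℝ) + μ * ((d 1 : ℕ) + a * (d 2 : ℕ)) = κ) := fun h =>
        hdE (Finset.mem_filter.2 ⟨hd, h⟩)
      rw [if_neg hdE, if_neg hne']
      simp
  have hne' : ∃ z, Ψ v₀ z ≠ 0 := by obtain ⟨z, hz⟩ := hne; exact ⟨z, by rwa [hΨ0]⟩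
  have hx₀' : Ψ v₀ x₀ = 0 := by rw [hΨ0]; exact hx₀
  obtain ⟨δ, hδ, hzero⟩ := exists_zero_near_of_near_paramP hcont hdiff hne' hx₀' hε
  -- the parameters attached to the window `n`: `L = log(2πn)`, `ε = (2πin)⁻¹`, `η = εμL`,
  -- `s_d = e^{-ex(d) L}`; all small for large `n`
  set Lf : ℕ → ℝ := fun n => Real.log (2 * Real.pi * n) with hLf
  have hL_t : Tendsto Lf atTop atTop :=
    Real.tendsto_log_atTop.comp (tendsto_natCast_atTop_atTop.const_mul_atTop Real.two_pi_pos)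
  have hsmall : ∀ᶠ n : ℕ in atTop, 1 ≤ n ∧ 1 / (2 * Real.pi * n) < δ ∧
      |μ| * Lf n / (2 * Real.pi * n) < δ ∧ ∀ d ∈ P.support, d ∉ Edge → Real.exp (-(ex d * Lf n)) < δ := by
    have h1 : ∀ᶠ n : ℕ in atTop, 1 ≤ n := eventually_ge_atTop 1
    have h2 : ∀ᶠ n : ℕ in atTop, 1 / (2 * Real.pi * n) < δ := by
      have h0 : Tendsto (fun n : ℕ => (2 * Real.pi * (n : ℝ))⁻¹) atTop (𝓝 0) :=
        (tendsto_natCast_atTop_atTop.const_mul_atTop Real.two_pi_pos).inv_tendsto_atTop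
      refine (h0.eventually (gt_mem_nhds hδ)).mono fun n hn => ?_
      rwa [one_div]
    have h3 : ∀ᶠ n : ℕ in atTop, |μ| * Lf n / (2 * Real.pi * n) < δ := by
      -- `log x / x → 0` along `x = 2πn`
      have hlog : Tendsto (fun n : ℕ => Lf n / (2 * Real.pi * n)) atTop (𝓝 0) := by
        have := Real.isLittleO_log_id_atTop.tendsto_div_nhds_zero.comp
          (tendsto_natCast_atTop_atTop.const_mul_atTop Real.two_pi_pos)
        simpa [hLf, Function.comp_def] using this
      have := hlog.const_mul |μ|
      rw [mul_zero] at this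
      refine (this.eventually (gt_mem_nhds hδ)).mono fun n hn => ?_
      rwa [mul_div_assoc]
    have h4 : ∀ᶠ n : ℕ in atTop, ∀ d ∈ P.support, d ∉ Edge → Real.exp (-(ex d * Lf n)) < δ := by
      refine (P.support.eventually_all (l := atTop)
        (p := fun d n => d ∉ Edge → Real.exp (-(ex d * Lf n)) < δ)).2 fun d hd => ?_
      by_cases hdE : d ∈ Edge
      · exact Filter.Eventually.of_forall fun n h => absurd hdE h
      · have hpos := hexE d hd hdE
        have : Tendsto (fun n => Real.exp (-(ex d * Lf n))) atTop (𝓝 0) :=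
          Real.tendsto_exp_neg_atTop_nhds_zero.comp (hL_t.const_mul_atTop hpos)
        exact (this.eventually (gt_mem_nhds hδ)).mono fun n hn _ => hn
    filter_upwards [h1, h2, h3, h4] with n h1 h2 h3 h4
    exact ⟨h1, h2, h3, h4⟩
  obtain ⟨N₁, hN₁⟩ := eventually_atTop.1 hsmall
  obtain ⟨n, hn, hnu⟩ := exists_nat_urot_near ha hu₀ (lt_min hδ hε) (max N N₁)
  obtain ⟨hn1, hεn, hηn, hsn⟩ := hN₁ n ((le_max_right _ _).trans hn)
  -- the concrete parameter
  set L : ℝ := Lf n with hL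
  set T : ℝ := 2 * Real.pi * n with hT
  have hn1' : (1 : ℝ) ≤ n := by exact_mod_cast hn1
  have hTpos : 0 < T := by rw [hT]; positivity
  have hTexp : Real.exp L = T := by rw [hL, hLf, Real.exp_log hTpos]
  set c : ℂ := (n : ℂ) * (2 * Real.pi * I) with hc
  have hcT : c = (T : ℂ) * I := by rw [hc, hT]; push_cast; ring
  have hc0 : c ≠ 0 := by
    rw [hcT]; exact mul_ne_zero (by exact_mod_cast hTpos.ne') Complex.I_ne_zero
  set εn : ℂ := c⁻¹ with hεn_def
  have hεc : εn * c = 1 := inv_mul_cancel₀ hc0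
  set ηn : ℂ := εn * ((μ * L : ℝ) : ℂ) with hηn_def
  set sn : ↥P.support → ℂ := fun d =>
    if d.1 ∈ Edge then 0 else ((Real.exp (-(ex d.1 * L)) : ℝ) : ℂ) with hsn_def
  set v : V := (urot (n * a), εn, ηn, sn) with hv
  -- it is `δ`-close to `v₀`
  have hεn_norm : ‖εn‖ = 1 / T := by
    rw [hεn_def, hcT, norm_inv, norm_mul, Complex.norm_real, Complex.norm_I, mul_one,
      Real.norm_eq_abs, abs_of_pos hTpos, one_div]
  have hLnn : 0 ≤ L := by
    rw [hL, hLf]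
    refine Real.log_nonneg ?_
    have := Real.pi_gt_three; nlinarith
  have hdist : dist v v₀ < δ := by
    rw [hv, hv₀, Prod.dist_eq, Prod.dist_eq, Prod.dist_eq, max_lt_iff, max_lt_iff, max_lt_iff]
    refine ⟨?_, ?_, ?_, ?_⟩
    · rw [dist_eq_norm]; exact hnu.trans_le (min_le_left _ _)
    · rw [dist_zero_right, hεn_norm, hT]; exact hεn
    · rw [dist_zero_right, hηn_def, norm_mul, hεn_norm, Complex.norm_real, Real.norm_eq_abs, abs_mul,
        abs_of_nonneg hLnn]
      calc 1 / T * (|μ| * L) = |μ| * Lf n / (2 * Real.pi * n) := by rw [hT, hL]; ring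
        _ < δ := hηn
    · rw [dist_pi_lt_iff hδ]
      intro d
      rw [dist_zero_right, hsn_def]
      by_cases hdE : d.1 ∈ Edge
      · simp only [hdE, if_true, norm_zero]; exact hδ
      · simp only [hdE, if_false, Complex.norm_real, Real.norm_eq_abs, abs_of_pos (Real.exp_pos _)]
        exact hsn d.1 d.2 hdE
  obtain ⟨ζ, hζ, hΨζ⟩ := hzero v hdist
  refine ⟨n, ζ, (le_max_left _ _).trans hn, hn1, hnu.trans_le (min_le_right _ _), hζ, ?_⟩
  -- the window identity `P(z; e^z, e^{az+b}) = e^{κL} Ψ_v(ζ)` at `z = ζ + μL + c`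
  have hLcast : (Real.log (2 * Real.pi * n) : ℝ) = L := by rw [hL, hLf]
  have hz : ζ + (μ : ℂ) * (Real.log (2 * Real.pi * (n : ℝ)) : ℝ) + (n : ℂ) * (2 * Real.pi * I) =
      (ζ + ((μ * L : ℝ) : ℂ)) + ((n : ℤ) : ℂ) * (2 * Real.pi * I) := by
    rw [hLcast]; push_cast; ring
  rw [hz, rfPt_add_int_mul, one_mul, show (((n : ℤ) : ℝ) * a) = (n : ℝ) * a by push_cast; ring,
    eval_fin3_eq_sum_monomials, ← hcf]
  -- `z = c (1 + ε ζ + η)`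
  have hzc : ζ + ((μ * L : ℝ) : ℂ) + ((n : ℤ) : ℂ) * (2 * Real.pi * I) = c * (1 + εn * ζ + ηn) := by
    have e1 : ((n : ℤ) : ℂ) * (2 * Real.pi * I) = c := by rw [hc]; push_cast; ring
    rw [e1, hηn_def]
    linear_combination (-(ζ) - ((μ * L : ℝ) : ℂ)) * hεc
  have hS_v : ∀ d ∈ P.support, S v d = ((Real.exp (-(ex d * L)) : ℝ) : ℂ) := by
    intro d hd
    rw [hS]
    by_cases hdE : d ∈ Edge
    · rw [if_pos hdE, hexEdge d hdE, zero_mul, neg_zero, Real.exp_zero]; simp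
    · rw [if_neg hdE, dif_pos hd]
      simp only [hv, hsn_def, hdE, if_false]
  have hterm : ∀ d ∈ P.support,
      P.coeff d * (ζ + ((μ * L : ℝ) : ℂ) + ((n : ℤ) : ℂ) * (2 * Real.pi * I)) ^ (d 0) *
        cf (monomial (Finsupp.tail d) 1) (urot (n * a)) (ζ + ((μ * L : ℝ) : ℂ)) =
      ((Real.exp (κ * L) : ℝ) : ℂ) * (P.coeff d * I ^ (d 0) * S v d *
        (1 + v.2.1 * ζ + v.2.2.1) ^ (d 0) * cf (monomial (Finsupp.tail d) 1) v.1 ζ) := by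
    intro d hd
    have hv1 : v.1 = urot (n * a) := rfl
    have hv21 : v.2.1 = εn := rfl
    have hv221 : v.2.2.1 = ηn := rfl
    rw [hv1, hv21, hv221, hS_v d hd, hzc, hcf, curveFn_monomial_add_real, ← hcf, mul_pow, hcT, mul_pow]
    have htail : ((Finsupp.tail d) 0 : ℝ) + a * ((Finsupp.tail d) 1 : ℝ) = w d := by
      simp only [hw, Finsupp.tail_apply, Fin.succ_zero_eq_one, Fin.succ_one_eq_two]
    rw [htail]
    -- real exponentials
    have hTk : ((T : ℂ)) ^ (d 0) = ((Real.exp ((d 0 : ℝ) * L) : ℝ) : ℂ) := by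
      rw [← hTexp, ← Complex.ofReal_pow, ← Real.exp_nat_mul]
    have hexp : ((Real.exp ((d 0 : ℝ) * L) : ℝ) : ℂ) * ((Real.exp (μ * L * w d) : ℝ) : ℂ) =
        ((Real.exp (κ * L) : ℝ) : ℂ) * ((Real.exp (-(ex d * L)) : ℝ) : ℂ) := by
      rw [← Complex.ofReal_mul, ← Complex.ofReal_mul, ← Real.exp_add, ← Real.exp_add]
      congr 2
      simp only [hex]; ring
    rw [hTk]
    calc P.coeff d * (((Real.exp ((d 0 : ℝ) * L) : ℝ) : ℂ) * I ^ (d 0) * (1 + εn * ζ + ηn) ^ (d 0)) *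
          (cf (monomial (Finsupp.tail d) 1) (urot (n * a)) ζ * ((Real.exp (μ * L * w d) : ℝ) : ℂ))
        = (((Real.exp ((d 0 : ℝ) * L) : ℝ) : ℂ) * ((Real.exp (μ * L * w d) : ℝ) : ℂ)) *
          (P.coeff d * I ^ (d 0) * (1 + εn * ζ + ηn) ^ (d 0) *
            cf (monomial (Finsupp.tail d) 1) (urot (n * a)) ζ) := by ring
      _ = _ := by rw [hexp]; ring
  rw [Finset.sum_congr rfl hterm, ← Finset.mul_sum, ← hΨ]
  rw [hΨζ, mul_zero]

end Tilted

end Summit.Schanuel.Schanuel.Theorems
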